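/-
COR-CM (cell pub-hodgecm2, stage 2 of the Hodge ladder) — count-neutral KERNEL COMBINATORICS «field level of the SYLOW TRANSFER, VI: every Galois CM
field of degree 8p, p ≥ 5 prime, has EXACTLY φ₂(F) generating faces — no hypothesis on the group» (seat prover-pub-hodgecm2-b23-g53-0, binder prover
b23, gen 53; own census lane SYLOW TRANSFER, blanket `CorCM/FaceSylowTransfer*` HOME/INBOX.md l.23357, claim l.24246).  Theorems only;
`Census/SylowTransferEightPrimeAll.lean` / `Census/SylowTransferShearedElements.lean` (this seat), the field transfer `CorCM/FaceGenerationTransfer.lean`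
and the INT2-GEN socket are used BY NAME; nothing asserted.  `Interfaces.lean` (C1), every E term, B01, `Transposition/*`, `PortJoin/*`, `D2Bridge/*`
untouched.  HONEST FRAMING: `HC_CM` is NOT proved, here or anywhere in the tree; this file produces no period and proves no face period for any
field; §2 is CONDITIONAL on the face periods exactly as the earlier sockets.
T5: n/a-class (hypothesis binders: `[F:ℚ] = 8p`, `p ≥ 5` prime — inhabited by `ℚ(ζ₁₆)⁺(i)·ℚ(ζ₁₁)⁺`-type composita, `D_{40}`-, `X₅`-fields; resp.
`[F:ℚ] = 8pᵏ` with an automorphism of order `pᵏ`; resp. a Galois subfield of degree `8` with `F/E` cyclic; checker: self, 2026-08-25).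
-/
import Summits.HodgeConjecture.CorCM.Census.SylowTransferEightPrimeAll
import Summits.HodgeConjecture.CorCM.FaceSylowTransfer
import HarnessLib

/-!
# Field level of the Sylow transfer, VI: every Galois CM field of degree `8p`, `p ≥ 5` prime

**`isLeast_card_faces_hgen_of_finrank_eq_eight_mul_prime`**: a Galois CM field `F` of degree `8p` (`p ≥ 5` prime; Galois group ANY of the groups of
order `8p`, complex conjugation ANY central involution) has EXACTLY `φ₂(F)` generating faces — σ₀ and the degree only
(`Census/SylowTransferEightPrimeAll.lean`: the Sylow `p`-subgroup is normal; dispatch over the Sylow `2`-subgroup).  Variants: degree `8pᵏ` (`p ≥ 5`) with an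
automorphism of order `pᵏ` (`…_of_aut_orderOf_prime_pow`); degree `8pᵏ` for EVERY odd prime `p` (so degree `24`) with a Galois subfield `E` of degree `8`
over which `F` is cyclic (`…_of_galois_subfield_eight`; degree `24`: every Galois CM field with a Galois octic subfield — every degree-`24` row but the
`SL(2,3)`-fields).  With part I (`8 ∤ [F:ℚ]`) and gen 50ʼs `FaceIndexTwoCyclic.isLeast_card_faces_hgen_of_finrank_lt_twentyfour` the open degrees below `64`
are `16`, `24` (`SL(2,3)`-fields only), `32`, `48`.  §2: the CONDITIONAL Hodge-conjecture readings through the INT2-GEN socket.  `HC_CM` is NOT proved.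

## References
* [Pohlmann1968] H. Pohlmann, Algebraic cycles on abelian varieties of complex multiplication type, Ann. of Math. 88 (1968), Thm 1.
* [Shimura1998] G. Shimura, Abelian Varieties with Complex Multiplication and Modular Functions, §6.2 Thm. 3, §8.1.
-/

noncomputable section

open CategoryTheory NumberField NumberField.ComplexEmbedding
open Literature.AlgebraicGeometry Literature.AlgebraicGeometry.Motives Literature.AlgebraicGeometry.HodgeTheory
open Literature.AlgebraicGeometry.ComplexMultiplication Literature.AlgebraicGeometry.Milne1999
open Literature.NumberTheory.Automorphic
open Literature.NumberTheory.Automorphic.PicardCM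
open Summit.HodgeConjecture.CorCM.Domination

namespace Summit.HodgeConjecture.CorCM.FaceSylowTransfer

open Summit.HodgeConjecture.CorCM.Prior.AllgGroup.RfwfAllgGroup
open Summit.HodgeConjecture.CorCM.Census.BlockParity
open Summit.HodgeConjecture.CorCM.Census.Coinvariant
open Summit.HodgeConjecture.CorCM.Census
open Summit.HodgeConjecture.CorCM.FaceCensus.OddSlice (galTOfAut galTOfAut_mul galTOfAut_conjAut)

section Field

variable {F : Type} [Field F] [NumberField F]

/-! ## §1 Exactly `φ₂(F)` generating faces -/

/-- **EVERY GALOIS CM FIELD OF DEGREE `8p`, `p ≥ 5` PRIME, HAS EXACTLY `φ₂(F)` GENERATING FACES** — no hypothesis on the Galois group. [folklore] -/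
theorem isLeast_card_faces_hgen_of_finrank_eq_eight_mul_prime [IsCMField F] [IsGalois ℚ F] {p : ℕ} (hp : p.Prime) (hp5 : 5 ≤ p)
    (hdeg : Module.finrank ℚ F = 8 * p) (σ₀ : F →+* ℂ) :
    IsLeast {n : ℕ | ∃ 𝒮 : Finset (Face F), 𝒮.card = n ∧
      ∀ f : Face F, lefChar f.corner (fun _ => ({σ₀} : Finset (F →+* ℂ))) ∈ AddSubgroup.closure
        {a : Asym F | ∃ g ∈ (𝒮 : Set (Face F)), ∃ σ : F →+* ℂ, a = lefChar g.corner (fun _ => ({σ} : Finset (F →+* ℂ)))}}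
      (fibreTwo (conjT : GalT F) conjT_mul_self) := by
  refine FaceTransfer.isLeast_card_faces_hgen_of_intrinsic _ ?_ (fun S₀ hS₀ hS => ?_) σ₀
  · obtain ⟨S, hS, hcard, hgen⟩ := (SylowTransfer.isLeast_card_gfaces_generate_fibreTwo_of_card_eq_eight_mul_prime_of_five_le conjT hp hp5
      ((FaceCensus.card_galT (F := F)).trans hdeg) conjT_mul_self conjT_ne_one FaceBasis.conjT_comm).1
    exact ⟨S, hS, hcard.le, hgen⟩
  · exact fibreTwo_le_card conjT conjT_mul_self FaceBasis.conjT_comm S₀ (Submodule.span ℤ (pairSet conjT)) le_rfl hS₀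
      (fun y hy => hS (gfaceSet_subset_hodgeSpan conjT conjT_mul_self hy))

/-- **EVERY GALOIS CM FIELD OF DEGREE `< 64` OTHER THAN `16, 24, 32, 48` HAS EXACTLY `φ₂(F)` GENERATING FACES** — part I (`8 ∤ [F:ℚ]`), gen 50ʼs
small degrees (`[F:ℚ] = 8`) and the rows `40 = 8·5`, `56 = 8·7` of this file; NO hypothesis on the Galois group.  (Degree `24`: see
`…_of_finrank_eq_twentyfour_of_galois_octic`.) [folklore] -/
theorem isLeast_card_faces_hgen_of_finrank_lt_sixtyFour [IsCMField F] [IsGalois ℚ F] (h64 : Module.finrank ℚ F < 64)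
    (h16 : Module.finrank ℚ F ≠ 16) (h24 : Module.finrank ℚ F ≠ 24) (h32 : Module.finrank ℚ F ≠ 32) (h48 : Module.finrank ℚ F ≠ 48)
    (σ₀ : F →+* ℂ) :
    IsLeast {n : ℕ | ∃ 𝒮 : Finset (Face F), 𝒮.card = n ∧
      ∀ f : Face F, lefChar f.corner (fun _ => ({σ₀} : Finset (F →+* ℂ))) ∈ AddSubgroup.closure
        {a : Asym F | ∃ g ∈ (𝒮 : Set (Face F)), ∃ σ : F →+* ℂ, a = lefChar g.corner (fun _ => ({σ} : Finset (F →+* ℂ)))}}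
      (fibreTwo (conjT : GalT F) conjT_mul_self) := by
  by_cases h8 : 8 ∣ Module.finrank ℚ F
  · obtain ⟨m, hm⟩ := h8
    have hpos : 0 < Module.finrank ℚ F := Module.finrank_pos
    have hm8 : m < 8 := by omega
    interval_cases m
    · omega
    · exact FaceIndexTwoCyclic.isLeast_card_faces_hgen_of_finrank_lt_twentyfour (by omega) (by omega) σ₀
    · omega
    · omega
    · omega
    · exact isLeast_card_faces_hgen_of_finrank_eq_eight_mul_prime (p := 5) (by norm_num) le_rfl hm σ₀
    · omega
    · exact isLeast_card_faces_hgen_of_finrank_eq_eight_mul_prime (p := 7) (by norm_num) (by norm_num) hm σ₀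
  · exact isLeast_card_faces_hgen_of_not_eight_dvd_finrank h8 σ₀

/-- **DEGREE `8pᵏ` (`p ≥ 5` PRIME, `k ≥ 1`), AN ELEMENT OF ORDER `pᵏ` IN THE GALOIS TRANSLATES ⟹ EXACTLY `φ₂(F)` GENERATING FACES.** [folklore] -/
theorem isLeast_card_faces_hgen_of_orderOf_prime_pow [IsCMField F] [IsGalois ℚ F] {p k : ℕ} (hp : p.Prime) (hp5 : 5 ≤ p) (hk : 1 ≤ k)
    (hdeg : Module.finrank ℚ F = 8 * p ^ k) (u : GalT F) (hord : orderOf u = p ^ k) (σ₀ : F →+* ℂ) :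
    IsLeast {n : ℕ | ∃ 𝒮 : Finset (Face F), 𝒮.card = n ∧
      ∀ f : Face F, lefChar f.corner (fun _ => ({σ₀} : Finset (F →+* ℂ))) ∈ AddSubgroup.closure
        {a : Asym F | ∃ g ∈ (𝒮 : Set (Face F)), ∃ σ : F →+* ℂ, a = lefChar g.corner (fun _ => ({σ} : Finset (F →+* ℂ)))}}
      (fibreTwo (conjT : GalT F) conjT_mul_self) := by
  refine FaceTransfer.isLeast_card_faces_hgen_of_intrinsic _ ?_ (fun S₀ hS₀ hS => ?_) σ₀
  · obtain ⟨S, hS, hcard, hgen⟩ := (SylowTransfer.isLeast_card_gfaces_generate_fibreTwo_of_card_eq_eight_mul_prime_pow_of_five_le conjT hp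
      hp5 hk ((FaceCensus.card_galT (F := F)).trans hdeg) u hord conjT_mul_self conjT_ne_one FaceBasis.conjT_comm).1
    exact ⟨S, hS, hcard.le, hgen⟩
  · exact fibreTwo_le_card conjT conjT_mul_self FaceBasis.conjT_comm S₀ (Submodule.span ℤ (pairSet conjT)) le_rfl hS₀
      (fun y hy => hS (gfaceSet_subset_hodgeSpan conjT conjT_mul_self hy))

/-- **… automorphism form**: `[F:ℚ] = 8pᵏ` (`p ≥ 5`) and `u₀ ∈ Aut(F)` of order `pᵏ`. [folklore] -/
theorem isLeast_card_faces_hgen_of_aut_orderOf_prime_pow [IsCMField F] [IsGalois ℚ F] (σ₀ : F →+* ℂ) {p k : ℕ} (hp : p.Prime)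
    (hp5 : 5 ≤ p) (hk : 1 ≤ k) (hdeg : Module.finrank ℚ F = 8 * p ^ k) (u₀ : F ≃ₐ[ℚ] F) (hord : orderOf u₀ = p ^ k) :
    IsLeast {n : ℕ | ∃ 𝒮 : Finset (Face F), 𝒮.card = n ∧
      ∀ f : Face F, lefChar f.corner (fun _ => ({σ₀} : Finset (F →+* ℂ))) ∈ AddSubgroup.closure
        {a : Asym F | ∃ g ∈ (𝒮 : Set (Face F)), ∃ σ : F →+* ℂ, a = lefChar g.corner (fun _ => ({σ} : Finset (F →+* ℂ)))}}
      (fibreTwo (conjT : GalT F) conjT_mul_self) := by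
  set e : (F ≃ₐ[ℚ] F) ≃* GalT F := MulEquiv.mk' (galTOfAut σ₀) (galTOfAut_mul σ₀) with he
  have hord' : orderOf (e u₀) = p ^ k := by rw [← hord]; exact orderOf_injective e.toMonoidHom e.injective u₀
  exact isLeast_card_faces_hgen_of_orderOf_prime_pow hp hp5 hk hdeg (e u₀) hord' σ₀

/-- **DEGREE `8pᵏ` (`p` ANY ODD PRIME, `k ≥ 1`) WITH A GALOIS SUBFIELD `E` OF DEGREE `8` OVER WHICH `F` IS CYCLIC ⟹ EXACTLY `φ₂(F)` GENERATING
FACES** (`E/ℚ` Galois is stated as «`Gal(F/E)` is normal in `Gal(F/ℚ)`»; then `Gal(F/E)` is a normal cyclic subgroup of order `pᵏ`; part XIII).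
[folklore] -/
theorem isLeast_card_faces_hgen_of_galois_subfield_eight [IsCMField F] [IsGalois ℚ F] (σ₀ : F →+* ℂ) {p k : ℕ} (hp : p.Prime)
    (hp2 : p ≠ 2) (hk : 1 ≤ k) (hdeg : Module.finrank ℚ F = 8 * p ^ k) (E : IntermediateField ℚ F) (hE : Module.finrank ℚ E = 8)
    (hEn : E.fixingSubgroup.Normal) (hcyc : IsCyclic E.fixingSubgroup) :
    IsLeast {n : ℕ | ∃ 𝒮 : Finset (Face F), 𝒮.card = n ∧
      ∀ f : Face F, lefChar f.corner (fun _ => ({σ₀} : Finset (F →+* ℂ))) ∈ AddSubgroup.closure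
        {a : Asym F | ∃ g ∈ (𝒮 : Set (Face F)), ∃ σ : F →+* ℂ, a = lefChar g.corner (fun _ => ({σ} : Finset (F →+* ℂ)))}}
      (fibreTwo (conjT : GalT F) conjT_mul_self) := by
  set e : (F ≃ₐ[ℚ] F) ≃* GalT F := MulEquiv.mk' (galTOfAut σ₀) (galTOfAut_mul σ₀) with he
  obtain ⟨g, hg⟩ := IsCyclic.exists_generator (α := E.fixingSubgroup)
  have hzp : Subgroup.zpowers (g : F ≃ₐ[ℚ] F) = E.fixingSubgroup := by
    apply le_antisymm (Subgroup.zpowers_le.mpr g.2)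
    intro x hx
    obtain ⟨m, hm⟩ := Subgroup.mem_zpowers_iff.mp (hg ⟨x, hx⟩)
    exact Subgroup.mem_zpowers_iff.mpr ⟨m, by rw [← Subgroup.coe_zpow, hm]⟩
  have hcardH : Nat.card E.fixingSubgroup = p ^ k := by
    have h2 := Module.finrank_mul_finrank ℚ E F
    rw [hE, hdeg] at h2
    rw [IsGalois.card_fixingSubgroup_eq_finrank E]
    exact Nat.eq_of_mul_eq_mul_left (by norm_num : 0 < 8) h2
  have hordg : orderOf (g : F ≃ₐ[ℚ] F) = p ^ k := by
    rw [Subgroup.orderOf_coe, orderOf_eq_card_of_forall_mem_zpowers hg, hcardH]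
  have hord' : orderOf (e g) = p ^ k := by rw [← hordg]; exact orderOf_injective e.toMonoidHom e.injective _
  have hzn : ∀ w : GalT F, w * e g * w⁻¹ ∈ Subgroup.zpowers (e (g : F ≃ₐ[ℚ] F)) := fun w => by
    obtain ⟨w₀, rfl⟩ := e.surjective w
    have hmem : w₀ * g * w₀⁻¹ ∈ Subgroup.zpowers (g : F ≃ₐ[ℚ] F) := by
      rw [hzp]
      exact hEn.conj_mem _ g.2 w₀
    obtain ⟨m, hm⟩ := Subgroup.mem_zpowers_iff.mp hmem
    refine Subgroup.mem_zpowers_iff.mpr ⟨m, ?_⟩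
    rw [← map_zpow, hm, map_mul, map_mul, map_inv]
  refine FaceTransfer.isLeast_card_faces_hgen_of_intrinsic _ ?_ (fun S₀ hS₀ hS => ?_) σ₀
  · obtain ⟨S, hS, hcard, hgen⟩ := (SylowTransfer.isLeast_card_gfaces_generate_fibreTwo_of_normal_zpowers_prime_pow conjT hp hp2 hk
      ((FaceCensus.card_galT (F := F)).trans hdeg) (e g) hord' hzn conjT_mul_self conjT_ne_one FaceBasis.conjT_comm).1
    exact ⟨S, hS, hcard.le, hgen⟩
  · exact fibreTwo_le_card conjT conjT_mul_self FaceBasis.conjT_comm S₀ (Submodule.span ℤ (pairSet conjT)) le_rfl hS₀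
      (fun y hy => hS (gfaceSet_subset_hodgeSpan conjT conjT_mul_self hy))

/-- **DEGREE `8p` (`p` ANY ODD PRIME) WITH A GALOIS SUBFIELD OF DEGREE `8` (`Gal(F/E) ⊴ Gal(F/ℚ)`) ⟹ EXACTLY `φ₂(F)` GENERATING FACES** (`Gal(F/E)` has
prime order, hence is cyclic). [folklore] -/
theorem isLeast_card_faces_hgen_of_galois_subfield_eight_mul_prime [IsCMField F] [IsGalois ℚ F] (σ₀ : F →+* ℂ) {p : ℕ} (hp : p.Prime)
    (hp2 : p ≠ 2) (hdeg : Module.finrank ℚ F = 8 * p) (E : IntermediateField ℚ F) (hE : Module.finrank ℚ E = 8)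
    (hEn : E.fixingSubgroup.Normal) :
    IsLeast {n : ℕ | ∃ 𝒮 : Finset (Face F), 𝒮.card = n ∧
      ∀ f : Face F, lefChar f.corner (fun _ => ({σ₀} : Finset (F →+* ℂ))) ∈ AddSubgroup.closure
        {a : Asym F | ∃ g ∈ (𝒮 : Set (Face F)), ∃ σ : F →+* ℂ, a = lefChar g.corner (fun _ => ({σ} : Finset (F →+* ℂ)))}}
      (fibreTwo (conjT : GalT F) conjT_mul_self) := by
  haveI : Fact p.Prime := ⟨hp⟩
  have hcardH : Nat.card E.fixingSubgroup = p := by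
    have h2 := Module.finrank_mul_finrank ℚ E F
    rw [hE, hdeg] at h2
    rw [IsGalois.card_fixingSubgroup_eq_finrank E]
    exact Nat.eq_of_mul_eq_mul_left (by norm_num : 0 < 8) h2
  have hcyc : IsCyclic E.fixingSubgroup := isCyclic_of_prime_card (p := p) hcardH
  exact isLeast_card_faces_hgen_of_galois_subfield_eight σ₀ hp hp2 (k := 1) le_rfl (by rw [pow_one, hdeg]) E hE hEn hcyc

/-- **DEGREE `24` WITH A GALOIS OCTIC SUBFIELD (`Gal(F/E) ⊴ Gal(F/ℚ)`) ⟹ EXACTLY `φ₂(F)` GENERATING FACES** — every Galois CM field of degree `24`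
except those with Galois group `SL(2,3)` (the last open degree-`24` row). [folklore] -/
theorem isLeast_card_faces_hgen_of_finrank_eq_twentyfour_of_galois_octic [IsCMField F] [IsGalois ℚ F] (σ₀ : F →+* ℂ)
    (hdeg : Module.finrank ℚ F = 24) (E : IntermediateField ℚ F) (hE : Module.finrank ℚ E = 8) (hEn : E.fixingSubgroup.Normal) :
    IsLeast {n : ℕ | ∃ 𝒮 : Finset (Face F), 𝒮.card = n ∧
      ∀ f : Face F, lefChar f.corner (fun _ => ({σ₀} : Finset (F →+* ℂ))) ∈ AddSubgroup.closure
        {a : Asym F | ∃ g ∈ (𝒮 : Set (Face F)), ∃ σ : F →+* ℂ, a = lefChar g.corner (fun _ => ({σ} : Finset (F →+* ℂ)))}}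
      (fibreTwo (conjT : GalT F) conjT_mul_self) :=
  isLeast_card_faces_hgen_of_galois_subfield_eight_mul_prime σ₀ Nat.prime_three (by norm_num) (by rw [hdeg]) E hE hEn

end Field

/-! ## §2 The Hodge-conjecture readings through the INT2-GEN socket (conditional on the face periods) -/

/-- **HC for the slice of a Galois CM field of degree `8p` (`p ≥ 5` prime), from `φ₂(K)` face periods** (CONDITIONAL; `HC_CM` is NOT proved).
[cite: Shimura1998, §6.2 Theorem 3 and §6.1 Corollary of Theorem 2 (pp. 41–43)] [cite: Pohlmann1968, Thm. 1]
[cite: Milne1999LefschetzClasses, Thm. 3.2 and Cor. 4.5] [cite: MumfordAV1970, §19 Thm. 1 and p. 169] -/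
theorem hodgeConjectureFor_of_finrank_eq_eight_mul_prime_of_exists_facePeriod (K : CMField) [hGal : IsGalois ℚ K] (σ₀ : (K : Type) →+* ℂ)
    {p : ℕ} (hp : p.Prime) (hp5 : 5 ≤ p) (hdeg : Module.finrank ℚ K = 8 * p) :
    ∃ 𝒮 : Finset (Face K), 𝒮.card = fibreTwo (conjT : GalT K) conjT_mul_self ∧
      ((∀ f ∈ 𝒮, ∃ ι₁ : K →+* ℂ, f.Admissible ι₁ ∧ ∃ (V : HermSpace3 K ι₁) (σ : K →+* ℂ),
        (Model.picardCMUniverse exists_isReal_hodgeModel_holds hodgePQ_independent_of_hodgeModel_holds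
          BallQuotient.ballQuotientUniformised_holds cmAbelianVarietyRealised_holds).PeriodNV ι₁ V K f.psi σ) →
      ∀ {P B : AbelianVariety ℂ}, AbelianVariety.IsProductOf (fun B : AbelianVariety ℂ =>
        ∃ (E : Type) (_ : Field E) (_ : NumberField E) (_ : IsCMField E) (_ : E →+* (K : Type)) (Φ : CMType E)
          (ι : 𝓞 E →+* End B) (ϑ : E →+* Module.End ℂ (complexBetti B.X 1)),
          IsCMTypeRealisation Φ B ι ϑ) P →
      AVDominatedBy B P → HodgeConjectureFor B.dim B.X) := by
  obtain ⟨⟨𝒮, hcard, hgen⟩, -⟩ := isLeast_card_faces_hgen_of_finrank_eq_eight_mul_prime (F := K) hp hp5 hdeg σ₀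
  refine ⟨𝒮, hcard, fun h P B hP hB => ?_⟩
  have h6 : 6 ≤ Module.finrank ℚ K := by rw [hdeg]; omega
  exact hodgeConjectureFor_of_avDominatedBy_isProductOf_of_exists_facePeriod_on K h6 (𝒮 : Set (Face K)) σ₀ hgen
    (fun f hf => h f (Finset.mem_coe.mp hf)) hP hB

/-- **HC for the slice of a Galois CM field of degree `8pᵏ` (`p ≥ 5` prime) with an automorphism of order `pᵏ`, from `φ₂(K)` face periods**
(CONDITIONAL; `HC_CM` is NOT proved). [cite: Shimura1998, §6.2 Theorem 3 and §6.1 Corollary of Theorem 2 (pp. 41–43)] [cite: Pohlmann1968, Thm. 1]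
[cite: Milne1999LefschetzClasses, Thm. 3.2 and Cor. 4.5] [cite: MumfordAV1970, §19 Thm. 1 and p. 169] -/
theorem hodgeConjectureFor_of_aut_orderOf_prime_pow_of_exists_facePeriod (K : CMField) [hGal : IsGalois ℚ K] (σ₀ : (K : Type) →+* ℂ)
    {p k : ℕ} (hp : p.Prime) (hp5 : 5 ≤ p) (hk : 1 ≤ k) (hdeg : Module.finrank ℚ K = 8 * p ^ k) (u₀ : (K : Type) ≃ₐ[ℚ] (K : Type))
    (hord : orderOf u₀ = p ^ k) :
    ∃ 𝒮 : Finset (Face K), 𝒮.card = fibreTwo (conjT : GalT K) conjT_mul_self ∧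
      ((∀ f ∈ 𝒮, ∃ ι₁ : K →+* ℂ, f.Admissible ι₁ ∧ ∃ (V : HermSpace3 K ι₁) (σ : K →+* ℂ),
        (Model.picardCMUniverse exists_isReal_hodgeModel_holds hodgePQ_independent_of_hodgeModel_holds
          BallQuotient.ballQuotientUniformised_holds cmAbelianVarietyRealised_holds).PeriodNV ι₁ V K f.psi σ) →
      ∀ {P B : AbelianVariety ℂ}, AbelianVariety.IsProductOf (fun B : AbelianVariety ℂ =>
        ∃ (E : Type) (_ : Field E) (_ : NumberField E) (_ : IsCMField E) (_ : E →+* (K : Type)) (Φ : CMType E)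
          (ι : 𝓞 E →+* End B) (ϑ : E →+* Module.End ℂ (complexBetti B.X 1)),
          IsCMTypeRealisation Φ B ι ϑ) P →
      AVDominatedBy B P → HodgeConjectureFor B.dim B.X) := by
  obtain ⟨⟨𝒮, hcard, hgen⟩, -⟩ := isLeast_card_faces_hgen_of_aut_orderOf_prime_pow (F := K) σ₀ hp hp5 hk hdeg u₀ hord
  refine ⟨𝒮, hcard, fun h P B hP hB => ?_⟩
  have h6 : 6 ≤ Module.finrank ℚ K := by
    rw [hdeg]
    have : p ≤ p ^ k := Nat.le_self_pow (Nat.one_le_iff_ne_zero.mp hk) p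
    omega
  exact hodgeConjectureFor_of_avDominatedBy_isProductOf_of_exists_facePeriod_on K h6 (𝒮 : Set (Face K)) σ₀ hgen
    (fun f hf => h f (Finset.mem_coe.mp hf)) hP hB

/-- **HC for the slice of a Galois CM field of degree `8p` (`p` any odd prime) with a Galois octic subfield, from `φ₂(K)` face periods** (CONDITIONAL;
`HC_CM` is NOT proved). [cite: Shimura1998, §6.2 Theorem 3 and §6.1 Corollary of Theorem 2 (pp. 41–43)] [cite: Pohlmann1968, Thm. 1]
[cite: Milne1999LefschetzClasses, Thm. 3.2 and Cor. 4.5] [cite: MumfordAV1970, §19 Thm. 1 and p. 169] -/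
theorem hodgeConjectureFor_of_galois_subfield_eight_mul_prime_of_exists_facePeriod (K : CMField) [hGal : IsGalois ℚ K]
    (σ₀ : (K : Type) →+* ℂ) {p : ℕ} (hp : p.Prime) (hp2 : p ≠ 2) (hdeg : Module.finrank ℚ K = 8 * p)
    (E : IntermediateField ℚ (K : Type)) (hE : Module.finrank ℚ E = 8) (hEn : E.fixingSubgroup.Normal) :
    ∃ 𝒮 : Finset (Face K), 𝒮.card = fibreTwo (conjT : GalT K) conjT_mul_self ∧
      ((∀ f ∈ 𝒮, ∃ ι₁ : K →+* ℂ, f.Admissible ι₁ ∧ ∃ (V : HermSpace3 K ι₁) (σ : K →+* ℂ),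
        (Model.picardCMUniverse exists_isReal_hodgeModel_holds hodgePQ_independent_of_hodgeModel_holds
          BallQuotient.ballQuotientUniformised_holds cmAbelianVarietyRealised_holds).PeriodNV ι₁ V K f.psi σ) →
      ∀ {P B : AbelianVariety ℂ}, AbelianVariety.IsProductOf (fun B : AbelianVariety ℂ =>
        ∃ (E : Type) (_ : Field E) (_ : NumberField E) (_ : IsCMField E) (_ : E →+* (K : Type)) (Φ : CMType E)
          (ι : 𝓞 E →+* End B) (ϑ : E →+* Module.End ℂ (complexBetti B.X 1)),
          IsCMTypeRealisation Φ B ι ϑ) P →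
      AVDominatedBy B P → HodgeConjectureFor B.dim B.X) := by
  obtain ⟨⟨𝒮, hcard, hgen⟩, -⟩ := isLeast_card_faces_hgen_of_galois_subfield_eight_mul_prime (F := K) σ₀ hp hp2 hdeg E hE hEn
  refine ⟨𝒮, hcard, fun h P B hP hB => ?_⟩
  have h6 : 6 ≤ Module.finrank ℚ K := by rw [hdeg]; have := hp.two_le; omega
  exact hodgeConjectureFor_of_avDominatedBy_isProductOf_of_exists_facePeriod_on K h6 (𝒮 : Set (Face K)) σ₀ hgen
    (fun f hf => h f (Finset.mem_coe.mp hf)) hP hB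

end Summit.HodgeConjecture.CorCM.FaceSylowTransfer
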